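import Mathlib
import HarnessLib
import Summits.Ventures.LatticeQCDFlow.Scaling.NonAbelianSeamHolonomy
import Summits.Ventures.LatticeQCDFlow.Scaling.TorusRankedMorseCount

/-!
# LatticeQCDFlow / Scaling — along the optimal Morse structure of `(ℤ/L)^d` the covered holonomies determine
# the field IF AND ONLY IF the gauge group is commutative (every `d ≥ 2`)

HONEST FRAMING: exact (Metropolis-corrected) sampling algorithms for lattice gauge theory;
figures of merit are autocorrelation/cost numbers at stated couplings and volumes; no
continuum-physics claim.

Venture `LatticeQCDFlow` (cell pub-lqcd), topic `Scaling`, FANOUT row 30 (lean-1, GEN-28) — OUR WORK on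
THEORY-2.md §4 row C5 (gen25 Q2; gen27 NOT-CLAIMED «non-abelian determination (false in general)»).  The
Morse structure `B` of `TorusRankedMorseStructure` ∕ `TorusRankedMorseCount` (plaquettes `(x; i<j)` with
`x_m = 0` for `m < i` and `x_i ≠ −1 ∨ (x_m = 0` for `i < m < j ∧ x_j ≠ −1)`) is OPTIMAL:
`#B = (d−1)(L^d − 1)`, the most an exact one-plaquette heat-bath autoregression can cover.
`AbelianHolonomyDetermination`: for a COMMUTATIVE group its covered holonomies determine every plaquette
holonomy.  `NonAbelianSeamHolonomy`: no collection of plaquettes disjoint from a seam STACK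
`{(x; i<j) : x_i = c_i, x_j = c_j}` determines a stack plaquette when the group has a non-commuting pair.

* §1 **`morse_disjoint_stack`** — the Morse structure MISSES every stack `{x_i = −1 ∧ x_j = −1}`, in every
  plane `(i, j)` (both disjuncts of its membership condition fail there);
* §2 **`morse_not_determined_of_noncomm`** — hence (`d ≥ 2`) for every group with `a b ≠ b a` there are two
  configurations with the same holonomy around every covered plaquette and holonomies `1` vs `[a,b] ≠ 1` (not
  conjugate) around the uncovered `p₀ = (−1,…,−1; 0<1)`;
* §3 **`morse_determine_iff_comm`** — `d ≥ 2`, `L ≥ 2`, `G` ANY group: the covered holonomies of the Morse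
  structure determine every plaquette holonomy of every `G`-configuration IF AND ONLY IF `G` is commutative.
  For `SU(2)` ∕ `SU(3)` the optimal exact one-plaquette heat-bath autoregression leaves the `k_min(d, L)`
  uncovered plaquettes genuinely random — not only their based holonomies but (stack plaquettes) their
  conjugacy classes, i.e. their weights.

No `def`, no `sorry`, nothing cited as a fact beyond the tree.
-/

namespace Summit.Ventures.LatticeQCDFlow.Theory2.Autoregressive

open Finset
open Literature.MathematicalPhysics.QuantumFieldTheory

variable {d L : ℕ} [NeZero L] {G : Type*} [Group G]

/-! ## §1 The Morse structure misses every `(−1, −1)` stack -/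

omit [Group G] in
/-- **The Morse structure misses the stack `{x_i = −1 ∧ x_j = −1}` of every plane.** [ours] -/
theorem morse_disjoint_stack (B : Finset (Plaquette d L))
    (hB : B = Finset.univ.filter (fun p : Plaquette d L =>
      (∀ m : Fin d, m < p.2.1.1 → p.1 m = 0) ∧
        (p.1 p.2.1.1 ≠ -1 ∨ ((∀ m : Fin d, p.2.1.1 < m → m < p.2.1.2 → p.1 m = 0) ∧ p.1 p.2.1.2 ≠ -1))))
    (i j : Fin d) :
    ∀ p ∈ B, ¬ (p.2.1.1 = i ∧ p.2.1.2 = j ∧ p.1 i = -1 ∧ p.1 j = -1) := by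
  rintro p hp ⟨hi, hj, hxi, hxj⟩
  rw [hB, Finset.mem_filter] at hp
  rcases hp.2.2 with h | ⟨-, h⟩
  · exact h (by rw [hi]; exact hxi)
  · exact h (by rw [hj]; exact hxj)

/-! ## §2 Non-determination along the Morse structure for a non-commuting pair -/

/-- **ALONG THE MORSE STRUCTURE A NON-COMMUTING PAIR LEAVES A PLAQUETTE FREE** (`d ≥ 2`): the two-seam
configuration through `(−1, −1)` in the plane `(0, 1)` agrees with the trivial one on every covered plaquette
and carries `[a, b] ≠ 1` — not conjugate to `1` — on the uncovered `p₀ = (−1,…,−1; 0<1)`. [ours] -/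
theorem morse_not_determined_of_noncomm (hd : 2 ≤ d) {a b : G} (hab : a * b ≠ b * a)
    (B : Finset (Plaquette d L))
    (hB : B = Finset.univ.filter (fun p : Plaquette d L =>
      (∀ m : Fin d, m < p.2.1.1 → p.1 m = 0) ∧
        (p.1 p.2.1.1 ≠ -1 ∨ ((∀ m : Fin d, p.2.1.1 < m → m < p.2.1.2 → p.1 m = 0) ∧ p.1 p.2.1.2 ≠ -1)))) :
    ∃ p₀ : Plaquette d L, p₀ ∉ B ∧ ∃ U V : GaugeConfig d L G,
      (∀ p ∈ B, plaquetteHolonomy U p.1 p.2.1.1 p.2.1.2 = plaquetteHolonomy V p.1 p.2.1.1 p.2.1.2) ∧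
      plaquetteHolonomy U p₀.1 p₀.2.1.1 p₀.2.1.2 = 1 ∧ plaquetteHolonomy V p₀.1 p₀.2.1.1 p₀.2.1.2 ≠ 1 ∧
      ¬ IsConj (plaquetteHolonomy U p₀.1 p₀.2.1.1 p₀.2.1.2) (plaquetteHolonomy V p₀.1 p₀.2.1.1 p₀.2.1.2) := by
  classical
  set i0 : Fin d := ⟨0, by omega⟩ with hi0
  set i1 : Fin d := ⟨1, by omega⟩ with hi1
  have h01 : i0 < i1 := by rw [hi0, hi1, Fin.lt_def]; norm_num
  set p₀ : Plaquette d L := (fun _ => (-1 : ZMod L), ⟨(i0, i1), h01⟩) with hp₀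
  have hstack : p₀.2.1.1 = i0 ∧ p₀.2.1.2 = i1 ∧ p₀.1 i0 = -1 ∧ p₀.1 i1 = -1 := ⟨rfl, rfl, rfl, rfl⟩
  have hdis := morse_disjoint_stack B hB i0 i1
  obtain ⟨U, V, hcov, hU, hV, hconj, -⟩ :=
    not_determined_of_disjoint_stack (L := L) hab h01 (-1) (-1) B hdis p₀ hstack
  exact ⟨p₀, fun h => hdis p₀ h hstack, U, V, hcov, hU, hV, hconj⟩

/-! ## §3 Determination along the Morse structure ⇔ commutative gauge group -/

/-- **ALONG THE OPTIMAL MORSE STRUCTURE OF `(ℤ/L)^d`, THE COVERED HOLONOMIES DETERMINE THE FIELD IFF THE GAUGE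
GROUP IS COMMUTATIVE** (`d ≥ 2`, `L ≥ 2`, `G` any group).  `⇐`: `#B = (d−1)(L^d−1)` (`card_morse`) and
`AbelianHolonomyDetermination.plaquetteHolonomy_eq_of_covered_eq`; `⇒`: §2. [ours] -/
theorem morse_determine_iff_comm (hd : 2 ≤ d) (hL : 2 ≤ L) (B : Finset (Plaquette d L))
    (t : Plaquette d L → Edge d L) (rank : Plaquette d L → ℕ)
    (hB : B = Finset.univ.filter (fun p : Plaquette d L =>
      (∀ m : Fin d, m < p.2.1.1 → p.1 m = 0) ∧
        (p.1 p.2.1.1 ≠ -1 ∨ ((∀ m : Fin d, p.2.1.1 < m → m < p.2.1.2 → p.1 m = 0) ∧ p.1 p.2.1.2 ≠ -1))))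
    (ht : t = fun p => if p.1 p.2.1.1 = -1 then (p.1.shift p.2.1.2, p.2.1.1) else (p.1.shift p.2.1.1, p.2.1.2))
    (hr : rank = fun p => 4 * ∑ m, (p.1 m).val + (if p.1 p.2.1.1 = -1 then 4 else 3) +
      (if p.1 p.2.1.2 = -1 then 4 else 3)) :
    (∀ U V : GaugeConfig d L G, (∀ p ∈ B, plaquetteHolonomy U p.1 p.2.1.1 p.2.1.2 = plaquetteHolonomy V p.1 p.2.1.1 p.2.1.2) →
        ∀ p' : Plaquette d L, plaquetteHolonomy U p'.1 p'.2.1.1 p'.2.1.2 = plaquetteHolonomy V p'.1 p'.2.1.1 p'.2.1.2) ↔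
      ∀ a b : G, a * b = b * a := by
  classical
  constructor
  · intro hdet a b
    by_contra hab
    obtain ⟨p₀, -, U, V, hcov, hU, hV, -⟩ := morse_not_determined_of_noncomm (L := L) hd hab B hB
    have h := hdet U V hcov p₀
    rw [hU] at h
    exact hV h.symm
  · intro hcomm U V hcov p'
    letI : CommGroup G := { (inferInstance : Group G) with mul_comm := hcomm }
    exact plaquetteHolonomy_eq_of_covered_eq (G := G) hL B t (fun p _ => morse_mem_links t ht p) rank
      (morse_rank_lt hL B t rank hB ht hr) (card_morse hL B hB) U V hcov p'

end Summit.Ventures.LatticeQCDFlow.Theory2.Autoregressive
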